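import Summits.Ventures.PercRepro2.UnionRowKGen
/-!
# One-kind instances of the union row from ONE avoidance fact (every number of observed vertices)
(blind cell PercRepro2, mine-1 g42; the k = 2 argument of proofs/MINE1-UNIONROW-THEOREM.md §4.2 for an arbitrary finite grid)

Setting of `UnionRowPeel` / `UnionRowKGen`: cells `ι`, masses `m ≥ 0`, a cut set `D`, cell sets `A`, `B`, the row
`rowV m D A B = Σ_{c ∉ D} m c (Z·1_A(c) − M(A)) (Z·1_B(c) − M(B))`.  The cut cells of `A ∩ B` and of `(A ∪ B)ᶜ` are the
BAD ones (their summand is positive); an instance is of the IN-kind when no cut cell lies outside `A ∪ B`.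

* `rowV_ge_cov_sub_bad`: for any instance with `D ⊆ A ∪ B`,
  `V ≥ Z·(Z·M(Aᶜ ∩ Bᶜ) − M(Aᶜ)·M(Bᶜ)) − M(D ∩ A ∩ B)·M(Aᶜ)·M(Bᶜ)`  (the good cut cells only help);
* `rowV_nonneg_in_kind`: if moreover `Aᶜ ∪ Bᶜ ⊆ R'` for a set `R'` missing the bad cells, ONE fact
  `M(Aᶜ)·M(Bᶜ) ≤ M(Aᶜ ∩ Bᶜ)·M(R')` (positive association of the down-sets `Aᶜ`, `Bᶜ` inside the avoidance set `R'`)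
  gives `V ≥ 0`: `ρ·V ≥ M(Aᶜ)M(Bᶜ)·(Z² − Z·ρ − ρ·δ) ≥ 0` because `ρ + δ ≤ Z`, with `ρ = M(R')`, `δ = M(D ∩ A ∩ B)`.
  On the three-status grid `R' = R'_W = {σ_w ≠ S ∀ w ∈ W}` with `{σ_w = S} ⊆ A ∩ B` for `w ∈ W` and every bad cell having
  some `σ_w = S`, `w ∈ W` — at k = 2 every one-kind terminal instance is of this form (the theorem's §4.2), at k = 3 324 of
  the 3,801 distinct one-kind terminal instances are (mine-1 g42 census), the others need more than one fact.
The OUT-kind is the mirror (`rowV_comm` and the complement symmetry) and is not repeated here.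
-/

namespace Summit.Ventures.PercRepro2.UnionRowOneKind

open Finset
open Summit.Ventures.PercRepro2.UnionRowPeel
open Summit.Ventures.PercRepro2.UnionRowKGen

variable {ι : Type*} [Fintype ι] [DecidableEq ι]

/-- For `D ⊆ A ∪ B` (no bad cut cell outside `A ∪ B`):
`V ≥ Z·(Z·M(Aᶜ∩Bᶜ) − M(Aᶜ)·M(Bᶜ)) − M(D∩A∩B)·M(Aᶜ)·M(Bᶜ)`. -/
theorem rowV_ge_cov_sub_bad {m : ι → ℝ} (hm : ∀ x, 0 ≤ m x) (D A B : Finset ι) (hD : D ⊆ A ∪ B) :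
    mass m univ * (mass m univ * mass m ((univ \ A) ∩ (univ \ B)) - mass m (univ \ A) * mass m (univ \ B))
      - mass m (D ∩ A ∩ B) * mass m (univ \ A) * mass m (univ \ B)
      ≤ rowV m D A B := by
  rw [rowV_expand]
  -- the masses
  have hZ := mass_nonneg hm univ
  have ha := mass_nonneg hm A
  have hb := mass_nonneg hm B
  have hAc : mass m (univ \ A) = mass m univ - mass m A := by
    have := mass_sdiff_add m (subset_univ A); linarith
  have hBc : mass m (univ \ B) = mass m univ - mass m B := by
    have := mass_sdiff_add m (subset_univ B); linarith
  have hAB : mass m (A ∩ B) + mass m (A ∪ B) = mass m A + mass m B := by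
    unfold mass; have := sum_union_inter (s₁ := A) (s₂ := B) (f := m); linarith
  have hAcBc : mass m ((univ \ A) ∩ (univ \ B)) = mass m univ - mass m (A ∪ B) := by
    have h1 := mass_sdiff_add m (subset_univ (A ∪ B))
    have heq : (univ \ A) ∩ (univ \ B) = univ \ (A ∪ B) := by
      ext c; simp only [mem_inter, mem_sdiff, mem_univ, true_and, mem_union]; tauto
    rw [heq]; linarith
  have hABD : mass m ((A ∩ B) \ D) = mass m (A ∩ B) - mass m (D ∩ A ∩ B) := by
    have h1 := mass_sdiff_add m (inter_subset_left (s₁ := A ∩ B) (s₂ := D))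
    rw [sdiff_inter_self_left] at h1
    have heq : (A ∩ B) ∩ D = D ∩ A ∩ B := by
      ext c; simp only [mem_inter]; tauto
    rw [heq] at h1; linarith
  have hBD : mass m (B \ D) = mass m B - mass m (B ∩ D) := by
    have h1 := mass_sdiff_add m (inter_subset_left (s₁ := B) (s₂ := D))
    rw [sdiff_inter_self_left] at h1; linarith
  have hAD : mass m (A \ D) = mass m A - mass m (A ∩ D) := by
    have h1 := mass_sdiff_add m (inter_subset_left (s₁ := A) (s₂ := D))
    rw [sdiff_inter_self_left] at h1; linarith
  have hUD : mass m (univ \ D) = mass m univ - mass m D := by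
    have := mass_sdiff_add m (subset_univ D); linarith
  -- inclusion–exclusion on D ⊆ A ∪ B: M(D) = M(D∩A) + M(D∩B) − M(D∩A∩B)
  have hDie : mass m D + mass m (D ∩ A ∩ B) = mass m (A ∩ D) + mass m (B ∩ D) := by
    have h1 : mass m ((D ∩ A) ∩ (D ∩ B)) + mass m ((D ∩ A) ∪ (D ∩ B)) = mass m (D ∩ A) + mass m (D ∩ B) := by
      unfold mass; have := sum_union_inter (s₁ := D ∩ A) (s₂ := D ∩ B) (f := m); linarith
    have e1 : (D ∩ A) ∩ (D ∩ B) = D ∩ A ∩ B := by ext c; simp only [mem_inter]; tauto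
    have e2 : (D ∩ A) ∪ (D ∩ B) = D := by
      ext c; simp only [mem_union, mem_inter]
      constructor
      · rintro (⟨h, _⟩ | ⟨h, _⟩) <;> exact h
      · intro h; have := hD h; simp only [mem_union] at this; tauto
    have e3 : mass m (D ∩ A) = mass m (A ∩ D) := by rw [inter_comm]
    have e4 : mass m (D ∩ B) = mass m (B ∩ D) := by rw [inter_comm]
    rw [e1, e2, e3, e4] at h1; linarith
  -- the bad cells are part of A ∩ D and of B ∩ D
  have hδA : mass m (D ∩ A ∩ B) ≤ mass m (A ∩ D) := by
    apply mass_mono hm; intro c hc; simp only [mem_inter] at hc ⊢; tauto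
  have hδB : mass m (D ∩ A ∩ B) ≤ mass m (B ∩ D) := by
    apply mass_mono hm; intro c hc; simp only [mem_inter] at hc ⊢; tauto
  have hu : mass m (A ∪ B) = mass m A + mass m B - mass m (A ∩ B) := by linarith
  have hd : mass m D = mass m (A ∩ D) + mass m (B ∩ D) - mass m (D ∩ A ∩ B) := by linarith
  rw [hABD, hBD, hAD, hUD, hAcBc, hAc, hBc, hu, hd]
  have hZa : 0 ≤ mass m univ - mass m A := by rw [← hAc]; exact mass_nonneg hm _
  have hZb : 0 ≤ mass m univ - mass m B := by rw [← hBc]; exact mass_nonneg hm _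
  -- V − bound = a(Z−b)(M(B∩D) − δ) + b(Z−a)(M(A∩D) − δ)
  nlinarith [mul_nonneg (mul_nonneg ha hZb) (sub_nonneg.2 hδB), mul_nonneg (mul_nonneg hb hZa) (sub_nonneg.2 hδA)]

/-- IN-kind instances from ONE fact: `D ⊆ A ∪ B`, `Aᶜ ⊆ R'`, `R'` disjoint from the bad cells `D ∩ A ∩ B`, and the
positive-association fact `M(Aᶜ)·M(Bᶜ) ≤ M(Aᶜ ∩ Bᶜ)·M(R')` force `V ≥ 0`.  (The fact is an avoidance-PA fact when also
`Bᶜ ⊆ R'`; the algebra does not need that inclusion.) -/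
theorem rowV_nonneg_in_kind {m : ι → ℝ} (hm : ∀ x, 0 ≤ m x) (D A B R' : Finset ι) (hD : D ⊆ A ∪ B)
    (hAR : univ \ A ⊆ R') (hRD : Disjoint R' (D ∩ A ∩ B))
    (hfact : mass m (univ \ A) * mass m (univ \ B) ≤ mass m ((univ \ A) ∩ (univ \ B)) * mass m R') :
    0 ≤ rowV m D A B := by
  have hlow := rowV_ge_cov_sub_bad hm D A B hD
  have hZ := mass_nonneg hm univ
  have hAc := mass_nonneg hm (univ \ A)
  have hBc := mass_nonneg hm (univ \ B)
  have hρ := mass_nonneg hm R'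
  have hδ := mass_nonneg hm (D ∩ A ∩ B)
  have hI := mass_nonneg hm ((univ \ A) ∩ (univ \ B))
  -- ρ + δ ≤ Z (disjoint subsets of the grid)
  have hρδ : mass m R' + mass m (D ∩ A ∩ B) ≤ mass m univ := by
    have h1 : mass m (R' ∪ (D ∩ A ∩ B)) = mass m R' + mass m (D ∩ A ∩ B) := by
      unfold mass; exact sum_union hRD
    have h2 := mass_mono hm (subset_univ (R' ∪ (D ∩ A ∩ B)))
    linarith
  have hAρ : mass m (univ \ A) ≤ mass m R' := mass_mono hm hAR
  by_cases h0 : mass m R' = 0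
  · -- then M(Aᶜ) = 0: the bad term vanishes and V ≥ Z²·M(Aᶜ∩Bᶜ) ≥ 0
    have hA0 : mass m (univ \ A) = 0 := le_antisymm (h0 ▸ hAρ) hAc
    rw [hA0] at hlow
    nlinarith [mul_nonneg (mul_nonneg hZ hZ) hI]
  · have hρpos : 0 < mass m R' := lt_of_le_of_ne hρ (Ne.symm h0)
    -- ρ·V ≥ M(Aᶜ)M(Bᶜ)·(Z² − Zρ − ρδ) ≥ 0
    have key : 0 ≤ mass m R' * rowV m D A B := by
      have e1 : 0 ≤ mass m univ * mass m univ - mass m univ * mass m R' - mass m R' * mass m (D ∩ A ∩ B) := by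
        nlinarith [mul_le_mul_of_nonneg_left hρδ hZ, mul_le_mul_of_nonneg_left hρδ hρ]
      have e2 := mul_nonneg (mul_nonneg hAc hBc) e1
      have e3 := mul_le_mul_of_nonneg_left hlow hρ
      have e4 := mul_le_mul_of_nonneg_left hfact (mul_nonneg hZ hZ)
      nlinarith [e2, e3, e4, mul_nonneg hρ hδ, mul_nonneg hAc hBc]
    nlinarith [key, hρpos]

end Summit.Ventures.PercRepro2.UnionRowOneKind
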